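import Literature.AlgebraicGeometry.Motives.IntegralModelReductionMapLifting
import Literature.AlgebraicGeometry.Resolution.AlterationsLemma32
import Literature.AlgebraicGeometry.Resolution.RegularLocalRingsProofs
import Literature.NumberTheory.EllipticCurves.NeronModelExtensionSetup
import Literature.AlgebraicGeometry.Morphisms.GenerizationsOfIntegralStalk
import HarnessLib

/-!
# The reduction map of a proper integral model separates the open-and-closed subschemes of the generic fibre
# ([SerreTate1968] §1; [Grothendieck1967] 17.5.8 (iii); [GortzWedhorn2020] §(3.4))

Topic `Literature/AlgebraicGeometry/Motives`, namespace `Literature.AlgebraicGeometry.Motives.IntegralModel`.  THEOREMS only (no def, no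
instance, no notation, no named fact, no `sorry`).  Cell `hodgecm-mathlib` (D-0151), FLOOR 0, programme F0P5a (D9op road 2′, crux item
stmt-HodgeConjecture-24832): the generic input (π0-2) of the support letter `SmoothProperModelSeparatesNabla` (`stub_π0` of the line
`F0_D9opRoad2`, ED4 §8 step 7 «reduction separates generic connected components»).

Base `R = closureValuationSubring (v.adicCompletion K) ⊆ Ω = \overline{K_v}`, `f = toClosureValuationSubring v : 𝓞ᵥ → R` as in ★
`IntegralModel.geomReductionMap` (p793383).  For a PROPER integral model `𝒳` of `Y` at `v`:

* `isDomain_stalk_of_smooth_of_isRegularRing`, `isDomain_stalk_total_of_smooth` — the local rings of a scheme SMOOTH over the spectrum of a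
  regular ring (e.g. the discrete valuation ring `𝓞ᵥ`) are regular ([Grothendieck1967] 17.5.8 (iii), ★ `Resolution.isRegularLocalRing_stalk_of_smooth`)
  hence DOMAINS ([Matsumura1987] 14.3, ★ `Resolution.isDomain_of_isRegularLocalRing`);
* `left_base_closedPoint_eq_of_geomReductionMap_eq` — two `Ω`-points with the same reduction have `R`-extensions (★ `extendPoint`) through the SAME
  point `z` of the total space (★ `reductionPoint_injective`, p794155);
* `modelPointsEquiv_symm_left` — the `Ω`-point of the total space attached to `y ∈ Y(Ω)` is `y` followed by the open immersion
  `Y ≅ 𝒳_K ↪ 𝒳` (adjunction counit = first projection);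
* **`exists_comp_eq_of_geomReductionMap_eq`** — if every local ring of `𝒳` is a domain (smooth models: above), `j : W ⟶ Y` is an open AND closed
  immersion, `y, y' ∈ Y(Ω)` have the same reduction and `y` factors through `j`, then so does `y'`: the generic points of the two extensions
  generize `z`, and generizations of a point with integral local ring lie in the same relatively open-and-closed subset of the open `𝒳_K ⊆ 𝒳`
  (★ `Morphisms.mem_of_specializes_of_isDomain_stalk`, [Stacks 01J7]);
* `exists_comp_eq_of_geomReductionMap_eq_of_isSmoothProper` — the same for a smooth proper model.

HC_CM is proved only modulo the 7 printed citations until rung 0 closes; this file is a generic leaf and changes no count.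

## References
* [SerreTate1968] J.-P. Serre, J. Tate, *Good reduction of abelian varieties*, Ann. of Math. 88 (1968), §1 (the reduction map).
* [Grothendieck1967] A. Grothendieck, EGA IV₄, Publ. Math. IHÉS 32 (1967), Prop. 17.5.8 (iii) (smooth over regular is regular).
* [Matsumura1987] H. Matsumura, *Commutative Ring Theory*, Thm. 14.3 (a regular local ring is a domain).
* [GortzWedhorn2020] U. Görtz, T. Wedhorn, *Algebraic Geometry I*, 2nd ed. (2020), Section (3.4), display (3.4.1) (generizations = `Spec 𝒪_{X,x}`).
* [StacksProject] The Stacks Project, Tag 01J7.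
-/

set_option autoImplicit false

noncomputable section

open CategoryTheory CategoryTheory.Limits AlgebraicGeometry IsDedekindDomain IsDedekindDomain.HeightOneSpectrum IsLocalRing
open scoped NumberField
open Literature.NumberTheory.EllipticCurves (genericFibre specGenericPoint)
open Literature.NumberTheory.GaloisRepresentations (closureValuationSubring)
open Literature.NumberTheory.DiophantineGeometry

namespace Literature.AlgebraicGeometry.Motives

universe u

/-! ### §1 Local rings of a scheme smooth over a regular base are domains -/

/-- **Smooth over the spectrum of a regular ring ⇒ integral local rings**: for `R` a regular (Noetherian) ring and `f : X → Spec R` smooth,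
every local ring `𝒪_{X,x}` is a regular local ring ([Grothendieck1967] 17.5.8 (iii), ★ `Resolution.isRegularLocalRing_stalk_of_smooth`; the
local rings of `Spec R` are the regular local rings `R_𝔭`), hence a domain ([Matsumura1987] Thm. 14.3, ★ `Resolution.isDomain_of_isRegularLocalRing`).
[cite: Grothendieck1967, Prop. 17.5.8 (iii) (PDF p. 69)] [cite: Matsumura1987, Thm. 14.3] -/
theorem isDomain_stalk_of_smooth_of_isRegularRing {R : Type u} [CommRing R] [IsRegularRing R] {X : Scheme.{u}}
    (f : X ⟶ Spec (.of R)) [Smooth f] (x : X) : IsDomain (X.presheaf.stalk x) := by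
  have hy : IsRegularLocalRing ((Spec (.of R)).presheaf.stalk (f x)) := by
    let p : PrimeSpectrum R := f x
    let e := IsLocalization.algEquiv p.asIdeal.primeCompl (Localization.AtPrime p.asIdeal)
      ((Spec.structureSheaf R).presheaf.stalk p)
    exact IsRegularLocalRing.of_ringEquiv e.toRingEquiv
  haveI := Resolution.isRegularLocalRing_stalk_of_smooth f x hy
  exact Resolution.isDomain_of_isRegularLocalRing _

namespace IntegralModel

variable {K : Type} [Field K] [NumberField K] {v : HeightOneSpectrum (𝓞 K)} {Y : SchemeOver K}

/-- **The local rings of the total space of a SMOOTH integral model over `𝓞ᵥ` are domains** (`𝓞ᵥ` is a discrete valuation ring, hence regular;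
[Grothendieck1967] 17.5.8 (iii) and [Matsumura1987] 14.3). [cite: Grothendieck1967, Prop. 17.5.8 (iii) (PDF p. 69)] [cite: Matsumura1987, Thm. 14.3] -/
theorem isDomain_stalk_total_of_smooth (𝒳 : IntegralModel (valuationSubringAtPrime K v) K Y) [Smooth 𝒳.total.hom] (z : 𝒳.total.left) :
    IsDomain (𝒳.total.left.presheaf.stalk z) :=
  isDomain_stalk_of_smooth_of_isRegularRing 𝒳.total.hom z

/-- The same for a smooth proper model of relative dimension `n` (`IsSmoothProper`). [cite: Grothendieck1967, Prop. 17.5.8 (iii) (PDF p. 69)] -/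
theorem IsSmoothProper.isDomain_stalk_total {𝒳 : IntegralModel (valuationSubringAtPrime K v) K Y} {n : ℕ} (h : 𝒳.IsSmoothProper n)
    (z : 𝒳.total.left) : IsDomain (𝒳.total.left.presheaf.stalk z) :=
  haveI := h.1
  haveI : Smooth 𝒳.total.hom := SmoothOfRelativeDimension.smooth n _
  𝒳.isDomain_stalk_total_of_smooth z

/-! ### §2 Two points with the same reduction: their integral extensions pass through the same point of the total space -/

/-- **Same reduction ⇒ same specialisation**: if `red_𝒳 y = red_𝒳 y'` then the `R`-points extending `y`, `y'` (★ `extendPoint`) have the same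
`κ(R)`-point (★ `reductionPoint_injective`). [cite: SerreTate1968, §1] -/
theorem specRingHomι_comp_extendPoint_eq_of_geomReductionMap_eq (𝒳 : IntegralModel (valuationSubringAtPrime K v) K Y) [IsProper 𝒳.total.hom]
    (y y' : AlgPoints Y (AlgebraicClosure (v.adicCompletion K))) (h : 𝒳.geomReductionMap y = 𝒳.geomReductionMap y') :
    specRingHomι (closureValuationSubring (v.adicCompletion K)) (toClosureValuationSubring v)
        (IsLocalRing.residue (closureValuationSubring (v.adicCompletion K))) ≫
      extendPoint (closureValuationSubring (v.adicCompletion K)) (toClosureValuationSubring v) 𝒳.total (𝒳.modelPointsEquiv.symm y) =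
    specRingHomι (closureValuationSubring (v.adicCompletion K)) (toClosureValuationSubring v)
        (IsLocalRing.residue (closureValuationSubring (v.adicCompletion K))) ≫
      extendPoint (closureValuationSubring (v.adicCompletion K)) (toClosureValuationSubring v) 𝒳.total (𝒳.modelPointsEquiv.symm y') := by
  apply 𝒳.reductionPoint_injective
  rw [← geomReductionMap_def, ← geomReductionMap_def]
  exact h

/-- **Same reduction ⇒ the two integral extensions pass through the same point `z` of the total space** (the image of the closed point of
`Spec R`). [cite: SerreTate1968, §1] -/
theorem left_base_closedPoint_eq_of_geomReductionMap_eq (𝒳 : IntegralModel (valuationSubringAtPrime K v) K Y) [IsProper 𝒳.total.hom]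
    (y y' : AlgPoints Y (AlgebraicClosure (v.adicCompletion K))) (h : 𝒳.geomReductionMap y = 𝒳.geomReductionMap y') :
    (extendPoint (closureValuationSubring (v.adicCompletion K)) (toClosureValuationSubring v) 𝒳.total (𝒳.modelPointsEquiv.symm y)).left
        (closedPoint (closureValuationSubring (v.adicCompletion K))) =
      (extendPoint (closureValuationSubring (v.adicCompletion K)) (toClosureValuationSubring v) 𝒳.total (𝒳.modelPointsEquiv.symm y')).left
        (closedPoint (closureValuationSubring (v.adicCompletion K))) := by
  haveI : IsLocalHom (CommRingCat.ofHom (IsLocalRing.residue (closureValuationSubring (v.adicCompletion K)))).hom :=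
    inferInstanceAs (IsLocalHom (IsLocalRing.residue (closureValuationSubring (v.adicCompletion K))))
  have e1 : (Spec.map (CommRingCat.ofHom (IsLocalRing.residue (closureValuationSubring (v.adicCompletion K)))))
      (closedPoint (ResidueField (closureValuationSubring (v.adicCompletion K)))) = closedPoint (closureValuationSubring (v.adicCompletion K)) :=
    Spec_closedPoint
  have hc := congrArg (fun φ => φ.left (closedPoint (ResidueField (closureValuationSubring (v.adicCompletion K)))))
    (𝒳.specRingHomι_comp_extendPoint_eq_of_geomReductionMap_eq y y' h)
  change (extendPoint (closureValuationSubring (v.adicCompletion K)) (toClosureValuationSubring v) 𝒳.total (𝒳.modelPointsEquiv.symm y)).left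
      ((Spec.map (CommRingCat.ofHom (IsLocalRing.residue (closureValuationSubring (v.adicCompletion K)))))
        (closedPoint (ResidueField (closureValuationSubring (v.adicCompletion K))))) =
    (extendPoint (closureValuationSubring (v.adicCompletion K)) (toClosureValuationSubring v) 𝒳.total (𝒳.modelPointsEquiv.symm y')).left
      ((Spec.map (CommRingCat.ofHom (IsLocalRing.residue (closureValuationSubring (v.adicCompletion K)))))
        (closedPoint (ResidueField (closureValuationSubring (v.adicCompletion K))))) at hc
  rwa [e1] at hc

/-! ### §3 The `Ω`-point of the total space attached to `y ∈ Y(Ω)` is `y` followed by the open immersion `Y ≅ 𝒳_K ↪ 𝒳` -/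

/-- **`e_𝒳⁻¹ y = y ≫ (genericIso)⁻¹ ≫ pr₁`** on underlying schemes: the `Ω`-point `Spec Ω → 𝒳` attached to `y ∈ Y(Ω)` by ★ `modelPointsEquiv` is `y`
followed by the inverse generic isomorphism `Y ≅ 𝒳 ×_{𝓞ᵥ} K` and the first projection (the counit of `Over.map ⊣ Over.pullback`).
[cite: Hartshorne1977, II.3 Thm. 3.3 (fibre product, universal property)] -/
theorem modelPointsEquiv_symm_left (𝒳 : IntegralModel (valuationSubringAtPrime K v) K Y) (y : AlgPoints Y (AlgebraicClosure (v.adicCompletion K))) :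
    (𝒳.modelPointsEquiv.symm y).left =
      y.left ≫ 𝒳.genericIso'.inv.left ≫ pullback.fst 𝒳.total.hom (specGenericPoint (valuationSubringAtPrime K v) K) := by
  set P := 𝒳.modelPointsEquiv.symm y with hP
  have hy : y = 𝒳.modelPointsEquiv P := (Equiv.apply_symm_apply _ _).symm
  rw [modelPointsEquiv_apply] at hy
  have h1 : ((Over.mapPullbackAdj (specGenericPoint (valuationSubringAtPrime K v) K)).homEquiv _ 𝒳.total).symm (y ≫ 𝒳.genericIso'.inv) =
      (specFractionFieldIso v).inv ≫ P := by
    apply ((Over.mapPullbackAdj (specGenericPoint (valuationSubringAtPrime K v) K)).homEquiv _ 𝒳.total).injective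
    rw [Equiv.apply_symm_apply, hy, Category.assoc, Iso.hom_inv_id, Category.comp_id]
  have h2 : P = (specFractionFieldIso v).hom ≫
      ((Over.mapPullbackAdj (specGenericPoint (valuationSubringAtPrime K v) K)).homEquiv _ 𝒳.total).symm (y ≫ 𝒳.genericIso'.inv) := by
    rw [h1, Iso.hom_inv_id_assoc]
  rw [h2, Adjunction.homEquiv_counit, Over.mapPullbackAdj_counit_app]
  change 𝟙 _ ≫ (y ≫ 𝒳.genericIso'.inv).left ≫ pullback.fst 𝒳.total.hom (specGenericPoint (valuationSubringAtPrime K v) K) = _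
  rw [Category.id_comp, Over.comp_left, Category.assoc]

/-- The generic point of the `R`-extension of `e_𝒳⁻¹ y` is the image of the point of `y` under `Y ≅ 𝒳_K ↪ 𝒳`, hence GENERIZES the point `z` through
which the extension passes. [cite: SerreTate1968, §1] [cite: GortzWedhorn2020, Section (3.4), display (3.4.1)] -/
theorem fst_genericIso_inv_pt_specializes (𝒳 : IntegralModel (valuationSubringAtPrime K v) K Y) [IsProper 𝒳.total.hom]
    (y : AlgPoints Y (AlgebraicClosure (v.adicCompletion K))) :
    (𝒳.genericIso'.inv.left ≫ pullback.fst 𝒳.total.hom (specGenericPoint (valuationSubringAtPrime K v) K)) y.pt ⤳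
      (extendPoint (closureValuationSubring (v.adicCompletion K)) (toClosureValuationSubring v) 𝒳.total (𝒳.modelPointsEquiv.symm y)).left
        (closedPoint (closureValuationSubring (v.adicCompletion K))) := by
  set Q := extendPoint (closureValuationSubring (v.adicCompletion K)) (toClosureValuationSubring v) 𝒳.total (𝒳.modelPointsEquiv.symm y)
    with hQ
  have hres : (𝒳.modelPointsEquiv.symm y).left =
      Spec.map (CommRingCat.ofHom (algebraMap (closureValuationSubring (v.adicCompletion K)) (AlgebraicClosure (v.adicCompletion K)))) ≫ Q.left := by
    rw [← restrictPoint_left, hQ, restrictPoint_extendPoint]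
  have hpt : (𝒳.genericIso'.inv.left ≫ pullback.fst 𝒳.total.hom (specGenericPoint (valuationSubringAtPrime K v) K)) y.pt =
      Q.left (Spec.map (CommRingCat.ofHom (algebraMap (closureValuationSubring (v.adicCompletion K))
        (AlgebraicClosure (v.adicCompletion K)))) (closedPoint (AlgebraicClosure (v.adicCompletion K)))) := by
    change (y.left ≫ 𝒳.genericIso'.inv.left ≫ pullback.fst 𝒳.total.hom (specGenericPoint (valuationSubringAtPrime K v) K))
        (closedPoint (AlgebraicClosure (v.adicCompletion K))) = _
    rw [← modelPointsEquiv_symm_left, hres]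
    rfl
  rw [hpt]
  exact Morphisms.specializes_base_closedPoint Q.left _

/-! ### §4 Reduction separates the open-and-closed subschemes of the generic fibre -/

/-- **The reduction map separates open-and-closed subschemes of the generic fibre** ([SerreTate1968] §1; [GortzWedhorn2020] §(3.4)): let `𝒳` be a
PROPER integral model of `Y` at `v` all of whose local rings are DOMAINS (e.g. `𝒳` smooth over `𝓞ᵥ`, `isDomain_stalk_total_of_smooth`), `j : W ⟶ Y`
an open AND closed immersion, and `y, y' ∈ Y(Ω)` with `red_𝒳 y = red_𝒳 y'`.  If `y` factors through `j` then so does `y'`.  Proof: the two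
`R`-extensions pass through one point `z` (`left_base_closedPoint_eq_of_geomReductionMap_eq`); their generic points `η, η'` lie in the open
`𝒳_K ≅ Y` of `𝒳` and generize `z`; generizations of a point with integral local ring lie in the same relatively open-and-closed subset of `𝒳_K`
(★ `Morphisms.mem_of_specializes_of_isDomain_stalk`, [Stacks 01J7]) — here the image of `W`; an `Ω`-point whose point lies in the image of the open
immersion `j` factors through `j`. [cite: SerreTate1968, §1] [cite: GortzWedhorn2020, Section (3.4), display (3.4.1)] [cite: StacksProject, Tag 01J7] -/
theorem exists_comp_eq_of_geomReductionMap_eq (𝒳 : IntegralModel (valuationSubringAtPrime K v) K Y) [IsProper 𝒳.total.hom]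
    (hdom : ∀ z : 𝒳.total.left, IsDomain (𝒳.total.left.presheaf.stalk z))
    {W : SchemeOver K} (j : W ⟶ Y) [IsOpenImmersion j.left] [IsClosedImmersion j.left]
    (y y' : AlgPoints Y (AlgebraicClosure (v.adicCompletion K))) (h : 𝒳.geomReductionMap y = 𝒳.geomReductionMap y')
    (w : AlgPoints W (AlgebraicClosure (v.adicCompletion K))) (hw : w ≫ j = y) :
    ∃ w' : AlgPoints W (AlgebraicClosure (v.adicCompletion K)), w' ≫ j = y' := by
  haveI : IsDiscreteValuationRing (valuationSubringAtPrime K v) :=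
    IsLocalization.AtPrime.isDiscreteValuationRing_of_dedekind_domain (𝓞 K) v.ne_bot _
  haveI : IsOpenImmersion (specGenericPoint (valuationSubringAtPrime K v) K) :=
    Literature.NumberTheory.EllipticCurves.isOpenImmersion_specGenericPoint _ _
  -- the open immersion `θ : Y ≅ 𝒳_K ↪ 𝒳`
  haveI : IsIso 𝒳.genericIso'.inv.left := by
    change IsIso ((Over.forget _).map 𝒳.genericIso'.inv)
    infer_instance
  obtain ⟨θ, hθ⟩ : ∃ θ : Y.left ⟶ 𝒳.total.left,
      θ = 𝒳.genericIso'.inv.left ≫ pullback.fst 𝒳.total.hom (specGenericPoint (valuationSubringAtPrime K v) K) := ⟨_, rfl⟩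
  -- (the source of `pr₁` must be spelled `(𝒳 ×_{𝓞ᵥ} K).left` for instance search)
  haveI : @IsOpenImmersion ((genericFibre (valuationSubringAtPrime K v) K).obj 𝒳.total).left 𝒳.total.left
      (pullback.fst 𝒳.total.hom (specGenericPoint (valuationSubringAtPrime K v) K)) :=
    inferInstanceAs (IsOpenImmersion (pullback.fst 𝒳.total.hom (specGenericPoint (valuationSubringAtPrime K v) K)))
  haveI : IsOpenImmersion 𝒳.genericIso'.inv.left := inferInstance
  haveI : IsOpenImmersion θ := by rw [hθ]; infer_instance
  have hθinj : Function.Injective θ := θ.isOpenEmbedding.injective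
  have hθopen : IsOpenMap θ := θ.isOpenEmbedding.isOpenMap
  -- the common point `z` and the two generizations
  set z := (extendPoint (closureValuationSubring (v.adicCompletion K)) (toClosureValuationSubring v) 𝒳.total (𝒳.modelPointsEquiv.symm y)).left
    (closedPoint (closureValuationSubring (v.adicCompletion K))) with hz
  haveI : IsDomain (𝒳.total.left.presheaf.stalk z) := hdom z
  have h₁ : θ y.pt ⤳ z := by rw [hθ]; exact 𝒳.fst_genericIso_inv_pt_specializes y
  have h₂ : θ y'.pt ⤳ z := by
    rw [hθ, hz, 𝒳.left_base_closedPoint_eq_of_geomReductionMap_eq y y' h]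
    exact 𝒳.fst_genericIso_inv_pt_specializes y'
  -- the relatively open-and-closed set `θ(j(W)) ⊆ θ(Y)`
  have hU : IsOpen (θ '' Set.range j.left) := hθopen _ j.left.isOpenEmbedding.isOpen_range
  have hGU : IsOpen (Set.range θ \ θ '' Set.range j.left) := by
    rw [← Set.image_compl_eq_range_sdiff_image hθinj]
    exact hθopen _ j.left.isClosedEmbedding.isClosed_range.isOpen_compl
  have hy₁ : θ y.pt ∈ θ '' Set.range j.left := ⟨y.pt, ⟨w.pt, by rw [← hw]; rfl⟩, rfl⟩
  have hy₂ : θ y'.pt ∈ Set.range θ := ⟨y'.pt, rfl⟩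
  have hmem : θ y'.pt ∈ θ '' Set.range j.left := Morphisms.mem_of_specializes_of_isDomain_stalk h₁ h₂ hU hGU hy₁ hy₂
  obtain ⟨t, ht, hty⟩ := hmem
  have hpt : y'.pt ∈ Set.range j.left := hθinj hty ▸ ht
  -- an `Ω`-point whose point lies in the image of the open immersion `j` factors through `j`
  refine ⟨AlgPoints.mk (IsOpenImmersion.lift j.left y'.left (by
      rintro _ ⟨s, rfl⟩
      obtain rfl : s = closedPoint (AlgebraicClosure (v.adicCompletion K)) := Subsingleton.elim _ _
      exact hpt)) (by rw [← Over.w j, IsOpenImmersion.lift_fac_assoc]; exact Over.w y'), ?_⟩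
  ext : 1
  simp only [Over.comp_left, Over.homMk_left]
  exact IsOpenImmersion.lift_fac _ _ _

/-- **Reduction modulo a SMOOTH PROPER model separates the open-and-closed subschemes of the generic fibre**: `exists_comp_eq_of_geomReductionMap_eq`
for `𝒳` smooth proper of relative dimension `n` (local rings are domains by `IsSmoothProper.isDomain_stalk_total`).
[cite: SerreTate1968, §1] [cite: Grothendieck1967, Prop. 17.5.8 (iii) (PDF p. 69)] -/
theorem exists_comp_eq_of_geomReductionMap_eq_of_isSmoothProper (𝒳 : IntegralModel (valuationSubringAtPrime K v) K Y) {n : ℕ}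
    (h𝒳 : 𝒳.IsSmoothProper n) {W : SchemeOver K} (j : W ⟶ Y) [IsOpenImmersion j.left] [IsClosedImmersion j.left]
    (y y' : AlgPoints Y (AlgebraicClosure (v.adicCompletion K)))
    (h : haveI := h𝒳.2; 𝒳.geomReductionMap y = 𝒳.geomReductionMap y')
    (w : AlgPoints W (AlgebraicClosure (v.adicCompletion K))) (hw : w ≫ j = y) :
    ∃ w' : AlgPoints W (AlgebraicClosure (v.adicCompletion K)), w' ≫ j = y' :=
  haveI := h𝒳.2
  𝒳.exists_comp_eq_of_geomReductionMap_eq h𝒳.isDomain_stalk_total j y y' h w hw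

end IntegralModel

end Literature.AlgebraicGeometry.Motives

end
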